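import Summits.KontsevichZagierPeriods.KontsevichZagierPeriods.Theses.GenusOneIterated

/-!
# `FayThreePoint` (stmt-KontsevichZagierPeriods-6782, route `GenusOneIterated`, support item)

Layer (F) of the genus-one iterated-integral sector, typed as pure algebra: for three points
`(xᵢ, yᵢ)` on a Weierstrass cubic `y² = 4x³ − g₂x − g₃` with pairwise distinct abscissae, the
algebraic third-kind kernels `F_ij = (yᵢ + yⱼ)/(2(xᵢ − xⱼ))` (`= ζ(zᵢ−zⱼ) − ζ(zᵢ) + ζ(zⱼ)` on a
smooth curve) satisfy

  `F₁₂F₂₃ + F₂₃F₃₁ + F₃₁F₁₂ + x₁ + x₂ + x₃ = 0`.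

Proof (elementary, valid for ALL real `g₂, g₃`, singular cubics included): over the common
denominator `4(x₁−x₂)(x₂−x₃)(x₃−x₁)` the numerator is
`Σ_cyc (y₁+y₂)(y₂+y₃)(x₃−x₁) = y₁²(x₂−x₃) + y₂²(x₃−x₁) + y₃²(x₁−x₂)` (the mixed terms `yᵢyⱼ` carry
the factor `(x₃−x₁)+(x₁−x₂)+(x₂−x₃) = 0`); substituting `yᵢ² = 4xᵢ³ − g₂xᵢ − g₃` kills the `g₂`
and `g₃` terms and leaves `4·Σ_cyc x₁³(x₂−x₃) = −4(x₁−x₂)(x₂−x₃)(x₃−x₁)(x₁+x₂+x₃)`.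
Function-theoretically this is the lowest Frobenius–Stickelberger identity
`(ζ(a)+ζ(b)+ζ(c))² = ℘(a)+℘(b)+℘(c)` (`a+b+c = 0`) combined with the addition theorem
`F_ij² = ℘(zᵢ−zⱼ) + xᵢ + xⱼ`.

Sources: D. F. Lawden, *Elliptic Functions and Applications* (1989), Ch. 6; [folklore].
-/

namespace Summit.KontsevichZagierPeriods.GenusOneIterated

/-- The cleared-denominator form of the three-point Fay identity: on `y² = 4x³ − g₂x − g₃`,
`Σ_cyc (y₁+y₂)(y₂+y₃)(x₃−x₁) = −4(x₁−x₂)(x₂−x₃)(x₃−x₁)(x₁+x₂+x₃)` (no distinctness needed).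
[folklore] -/
theorem fay_numerator_identity (g₂ g₃ x₁ y₁ x₂ y₂ x₃ y₃ : ℝ)
    (h₁ : y₁ ^ 2 = 4 * x₁ ^ 3 - g₂ * x₁ - g₃) (h₂ : y₂ ^ 2 = 4 * x₂ ^ 3 - g₂ * x₂ - g₃)
    (h₃ : y₃ ^ 2 = 4 * x₃ ^ 3 - g₂ * x₃ - g₃) :
    (y₁ + y₂) * (y₂ + y₃) * (x₃ - x₁) + (y₂ + y₃) * (y₃ + y₁) * (x₁ - x₂)
        + (y₃ + y₁) * (y₁ + y₂) * (x₂ - x₃)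
      = -4 * ((x₁ - x₂) * (x₂ - x₃) * (x₃ - x₁)) * (x₁ + x₂ + x₃) := by
  linear_combination (x₂ - x₃) * h₁ + (x₃ - x₁) * h₂ + (x₁ - x₂) * h₃

/-- **Three-point Fay identity** (route item `GenusOneIterated.FayThreePoint`, stmt-6782): for three
points on `y² = 4x³ − g₂x − g₃` with pairwise distinct abscissae and `F_ij = (yᵢ + yⱼ)/(2(xᵢ − xⱼ))`,
`F₁₂F₂₃ + F₂₃F₃₁ + F₃₁F₁₂ + (x₁ + x₂ + x₃) = 0`. [folklore] -/
theorem fayThreePoint_proof :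
    Summit.KontsevichZagierPeriods.KontsevichZagierPeriods.Theses.GenusOneIterated.FayThreePoint := by
  unfold Summit.KontsevichZagierPeriods.KontsevichZagierPeriods.Theses.GenusOneIterated.FayThreePoint
  intro g₂ g₃ x₁ y₁ x₂ y₂ x₃ y₃ h₁ h₂ h₃ h12 h23 h31
  have d12 : x₁ - x₂ ≠ 0 := sub_ne_zero.mpr h12
  have d23 : x₂ - x₃ ≠ 0 := sub_ne_zero.mpr h23
  have d31 : x₃ - x₁ ≠ 0 := sub_ne_zero.mpr h31
  have hV : 4 * ((x₁ - x₂) * (x₂ - x₃) * (x₃ - x₁)) ≠ 0 :=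
    mul_ne_zero four_ne_zero (mul_ne_zero (mul_ne_zero d12 d23) d31)
  have key := fay_numerator_identity g₂ g₃ x₁ y₁ x₂ y₂ x₃ y₃ h₁ h₂ h₃
  -- rewrite the sum of the three products over the common denominator
  have hsum :
      (y₁ + y₂) / (2 * (x₁ - x₂)) * ((y₂ + y₃) / (2 * (x₂ - x₃)))
        + (y₂ + y₃) / (2 * (x₂ - x₃)) * ((y₃ + y₁) / (2 * (x₃ - x₁)))
        + (y₃ + y₁) / (2 * (x₃ - x₁)) * ((y₁ + y₂) / (2 * (x₁ - x₂)))
      = ((y₁ + y₂) * (y₂ + y₃) * (x₃ - x₁) + (y₂ + y₃) * (y₃ + y₁) * (x₁ - x₂)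
          + (y₃ + y₁) * (y₁ + y₂) * (x₂ - x₃)) / (4 * ((x₁ - x₂) * (x₂ - x₃) * (x₃ - x₁))) := by
    rw [eq_div_iff hV]
    field_simp
    ring
  rw [hsum, key]
  have hcancel : -4 * ((x₁ - x₂) * (x₂ - x₃) * (x₃ - x₁)) * (x₁ + x₂ + x₃)
      / (4 * ((x₁ - x₂) * (x₂ - x₃) * (x₃ - x₁))) = -(x₁ + x₂ + x₃) := by
    rw [div_eq_iff hV]
    ring
  rw [hcancel]
  ring

end Summit.KontsevichZagierPeriods.GenusOneIterated
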